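import Literature.AlgebraicGeometry.Frobenioids.BaseSquareUniqueness
import HarnessLib

/-!
# Frobenioids I, Corollary 4.12 — `1`-uniqueness of `Ψ⁰ : F_{0_{D₁}} ⥤ F_{0_{D₂}}` and the reduction of
# Cor. 4.12 to the existence of a `1`-commuting equivalence (resp. to a base square and the
# preservation of Frobenius degrees)

Mochizuki, *The geometry of Frobenioids I: the general theory*, Kyushu J. Math. **62** (2008)
293–400, kurims text Cor. 4.12 and its proof pp. 94–95 [cite: MochizukiFrdI2008, Cor. 4.12 p.95].

PROOF-ONLY companion of `DivisorMonoidCategoryTheoreticity.lean` (seat abc-iut-L1-t3: `S.toBaseDeg : C ⥤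
D × N_{≥1}`, "`F_{0_D}` is the product category of `D` with the one-object category determined by the
monoid `N_{≥1}`" (Prop. 4.4 (i) p. 83), and the typed `Cor412`), generic over
`S_i : PreFrobenioidData C_i D_i`. The "`D^* ⥲ D`" technique of `BaseSquareUniqueness.lean`, now for functors
out of `D₁ × N_{≥1}`: a morphism `(f, n)` factors as `(f, 1) ≫ (id, n)`; `(f, 1)` is handled by pull-back
morphisms (Def. 1.3 (i)(c), linear by (iv)(b)), `(id, n)` by the morphisms of Frobenius type of degree `n`
out of every object (Def. 1.3 (ii)), and objects over isomorphic bases by Def. 1.3 (i)(b) (pre-steps):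

* `nonempty_iso_of_iso_whisker_toBaseDeg`: whiskering with `C₁ → D₁ × N_{≥1}` reflects isomorphy of functors;
* `oneUniqueSquare_toBaseDeg_of_oneCommutes`: ANY equivalence `Ψ⁰` `1`-commuting with `Ψ` over the
  projections `C_i → D_i × N_{≥1}` is `1`-unique ("there exists a 1-unique functor `Ψ⁰`", p. 95);
* `isRigidFunctor_comp_toBaseDeg`: rigidity of `T ⋙ (C → D)` gives rigidity of `T ⋙ (C → D × N_{≥1})`
  ("the rigidity assertion follows from Proposition 1.13, (i)", p. 95);
* `exists_toBaseDeg_equivalence_of_base_square`: a base square `Base₂ ∘ Ψ ≅ Ψ^Base ∘ Base₁` with `Ψ^Base`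
  an equivalence, together with "`Ψ` preserves Frobenius degrees", yields `Ψ⁰ := Ψ^Base × id`
  `1`-commuting with `Ψ` (the situation of Cor. 4.11 (ii), (iv) over Div-slim bases; print's general
  argument passes through `C^birat`, Cor. 4.10 and Thm. 3.4 (iv) instead);
* `cor412_of_exists_toBaseDeg_equivalence`, `cor412_of_base_square`: the typed Cor. 4.12 from these inputs.

No statement of the paper is strengthened; nothing here is specific to the abc programme.
-/

namespace Literature.AlgebraicGeometry.Frobenioids

open CategoryTheory Opposite CategoryTheory.Prod

universe w₁ w₂ v₁ v₁' v₂ v₂' v₃ u₁ u₁' u₂ u₂' u₃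

namespace PreFrobenioidData

section OneFrobenioid

variable {C₁ : Type u₁} [Category.{v₁} C₁] {D₁ : Type u₁'} [Category.{v₁'} D₁]
variable {S₁ : PreFrobenioidData.{w₁} C₁ D₁}
variable {E : Type u₃} [Category.{v₃} E]

/-- "There exists a `1`-UNIQUE functor `Ψ⁰`" (FrdI Cor. 4.12 p. 95), the uniqueness mechanism: under
Def. 1.3 (i)(a), (i)(b) [pre-steps], (i)(c)+(iv)(b) [linear lifts of base arrows] and (ii) [morphisms of
Frobenius type of every degree out of every object] of `C₁ → D₁` in operations form, whiskering with the
projection `C₁ → D₁ × N_{≥1}`, `A ↦ (Base A, *)`, `φ ↦ (Base φ, deg_Fr φ)`, reflects isomorphy of functors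
out of `D₁ × N_{≥1}`. [cite: MochizukiFrdI2008, Cor. 4.12 p.95] -/
theorem nonempty_iso_of_iso_whisker_toBaseDeg
    (hbase : ∀ X : D₁, ∃ A : C₁, Nonempty (S₁.base.obj A ≅ X))
    (hconn : ∀ (A B : C₁) (g : S₁.base.obj A ≅ S₁.base.obj B), ∃ (X : C₁) (φ : X ⟶ A) (ψ : X ⟶ B),
      IsIso (S₁.base.map φ) ∧ S₁.degFr φ = 1 ∧ S₁.degFr ψ = 1 ∧ S₁.base.map φ ≫ g.hom = S₁.base.map ψ)
    (hpb : ∀ (A : C₁) {Y : D₁} (f : Y ⟶ S₁.base.obj A),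
      ∃ (A' : C₁) (φ : A' ⟶ A) (e : S₁.base.obj A' ≅ Y), S₁.base.map φ = e.hom ≫ f ∧ S₁.degFr φ = 1)
    (hfrob : ∀ (A : C₁) (n : ℕ+), ∃ (B : C₁) (γ : A ⟶ B), IsIso (S₁.base.map γ) ∧ S₁.degFr γ = n)
    {G G' : D₁ × SingleObj ℕ+ ⥤ E} (τ : S₁.toBaseDeg ⋙ G ≅ S₁.toBaseDeg ⋙ G') : Nonempty (G ≅ G') := by
  classical
  -- the identity of `N_{≥1}` as an arrow of the one-object category
  have hone : ∀ u : SingleObj ℕ+, (𝟙 u : u ⟶ u) = (1 : ℕ+) := fun _ => rfl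
  -- pointwise form of `τ`, at `(Base A, u)` for every `u` (all objects of `N_{≥1}` are the same)
  let t : ∀ (A : C₁) (u : SingleObj ℕ+), G.obj (S₁.base.obj A, u) ≅ G'.obj (S₁.base.obj A, u) :=
    fun A _ => τ.app A
  have ht : ∀ ⦃A B : C₁⦄ (φ : A ⟶ B) (u v : SingleObj ℕ+),
      G.map (S₁.base.map φ ×ₘ (S₁.degFr φ : u ⟶ v)) ≫ (t B v).hom =
        (t A u).hom ≫ G'.map (S₁.base.map φ ×ₘ (S₁.degFr φ : u ⟶ v)) :=
    fun A B φ _ _ => τ.hom.naturality φ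
  -- INDEPENDENCE over base-isomorphisms `(g, 1)`, from (i)(b)
  have hind : ∀ {A₀ A : C₁} (g : S₁.base.obj A₀ ≅ S₁.base.obj A) (u : SingleObj ℕ+),
      G.map (g.hom ×ₘ 𝟙 u) ≫ (t A u).hom = (t A₀ u).hom ≫ G'.map (g.hom ×ₘ 𝟙 u) := by
    intro A₀ A g u
    obtain ⟨X, φ, ψ, hφ, hφ1, hψ1, hg⟩ := hconn A₀ A g
    have h1 := ht φ u u
    have h2 := ht ψ u u
    rw [hφ1, ← hone u] at h1
    rw [hψ1, ← hone u, ← hg] at h2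
    -- `(Base φ, 1)` is invertible
    let I : ((S₁.base.obj X, u) : D₁ × SingleObj ℕ+) ≅ (S₁.base.obj A₀, u) :=
      Iso.prod (asIso (S₁.base.map φ)) (Iso.refl u)
    have hI : I.hom = S₁.base.map φ ×ₘ 𝟙 u := rfl
    rw [← hI] at h1
    have hfac : ((S₁.base.map φ ≫ g.hom) ×ₘ 𝟙 u : ((S₁.base.obj X, u) : D₁ × SingleObj ℕ+) ⟶ (S₁.base.obj A, u)) =
        I.hom ≫ (g.hom ×ₘ 𝟙 u) := by
      rw [hI]; ext <;> simp
    rw [hfac, G.map_comp, G'.map_comp, Category.assoc] at h2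
    rw [← cancel_epi (G.map I.hom), h2, reassoc_of% h1]
  -- NATURALITY ALONG `(id, n)` at a base object, from (ii) and independence
  have hdeg : ∀ (A : C₁) {u v : SingleObj ℕ+} (n : u ⟶ v),
      G.map (𝟙 (S₁.base.obj A) ×ₘ n) ≫ (t A v).hom = (t A u).hom ≫ G'.map (𝟙 (S₁.base.obj A) ×ₘ n) := by
    intro A u v n
    obtain ⟨B, γ, hγ, hγn⟩ := hfrob A n
    have h1 := ht γ u v
    rw [hγn] at h1
    have h2 := hind (asIso (S₁.base.map γ)) v
    let I : ((S₁.base.obj A, v) : D₁ × SingleObj ℕ+) ≅ (S₁.base.obj B, v) :=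
      Iso.prod (asIso (S₁.base.map γ)) (Iso.refl v)
    have hI : I.hom = (asIso (S₁.base.map γ)).hom ×ₘ 𝟙 v := rfl
    rw [← hI] at h2
    have hfac : (S₁.base.map γ ×ₘ (n : u ⟶ v) : ((S₁.base.obj A, u) : D₁ × SingleObj ℕ+) ⟶ (S₁.base.obj B, v)) =
        (𝟙 (S₁.base.obj A) ×ₘ n) ≫ I.hom := by
      rw [hI]; ext <;> simp
    rw [hfac, G.map_comp, G'.map_comp, Category.assoc, h2] at h1
    rw [← cancel_mono (G'.map I.hom)]
    simpa only [Category.assoc] using h1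
  -- choices (i)(a): `A X`, `e X : Base (A X) ≅ X`
  choose A hA using hbase
  have e : ∀ X : D₁, S₁.base.obj (A X) ≅ X := fun X => (hA X).some
  -- components at `P = (X, u)`: transport `t (A X) u` along `(e X, 1)`
  let I : ∀ P : D₁ × SingleObj ℕ+, ((S₁.base.obj (A P.1), P.2) : D₁ × SingleObj ℕ+) ≅ P := fun P =>
    Iso.prod (e P.1) (Iso.refl P.2)
  let c : ∀ P : D₁ × SingleObj ℕ+, G.obj P ≅ G'.obj P := fun P =>
    G.mapIso (I P).symm ≪≫ t (A P.1) P.2 ≪≫ G'.mapIso (I P)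
  refine ⟨NatIso.ofComponents c ?_⟩
  rintro ⟨Y, u⟩ ⟨X, u'⟩ ⟨f, n⟩
  show G.map (f ×ₘ n) ≫ G.map ((e X).inv ×ₘ 𝟙 u') ≫ (t (A X) u').hom ≫ G'.map ((e X).hom ×ₘ 𝟙 u') =
    (G.map ((e Y).inv ×ₘ 𝟙 u) ≫ (t (A Y) u).hom ≫ G'.map ((e Y).hom ×ₘ 𝟙 u)) ≫ G'.map (f ×ₘ n)
  -- (i)(c): lift `f ≫ (e X)⁻¹` to a linear `φ : A' → A X` up to `e' : Base A' ≅ Y`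
  obtain ⟨A', φ, e', hφ, hφ1⟩ := hpb (A X) (f ≫ (e X).inv)
  have h1 := ht φ u u
  rw [hφ, hφ1, ← hone u] at h1
  -- independence between `A'` and `A Y` along `J := (e' ≫ (e Y)⁻¹, 1)`, and naturality along `(id, n)` at `A X`
  let J : ((S₁.base.obj A', u) : D₁ × SingleObj ℕ+) ≅ (S₁.base.obj (A Y), u) :=
    Iso.prod (e' ≪≫ (e Y).symm) (Iso.refl u)
  have h2 : (G.mapIso J).hom ≫ (t (A Y) u).hom = (t A' u).hom ≫ (G'.mapIso J).hom := hind (e' ≪≫ (e Y).symm) u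
  have h2' : (t (A Y) u).hom = (G.mapIso J).inv ≫ (t A' u).hom ≫ (G'.mapIso J).hom :=
    ((Iso.inv_comp_eq _).mpr h2.symm).symm
  have h3 := hdeg (A X) n
  -- the left-hand side: `(f, n) ≫ ((e X)⁻¹, 1) = (e'⁻¹, 1) ≫ (e' ≫ f ≫ (e X)⁻¹, 1) ≫ (id, n)`
  have eL : G.map (f ×ₘ n) ≫ G.map ((e X).inv ×ₘ 𝟙 u') =
      G.map (e'.inv ×ₘ 𝟙 u) ≫ G.map ((e'.hom ≫ f ≫ (e X).inv) ×ₘ 𝟙 u) ≫ G.map (𝟙 (S₁.base.obj (A X)) ×ₘ n) := by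
    rw [← G.map_comp, ← G.map_comp, ← G.map_comp]
    congr 1
    ext <;> simp
  have hP : (((e Y).inv ×ₘ 𝟙 u) : ((Y, u) : D₁ × SingleObj ℕ+) ⟶ (S₁.base.obj (A Y), u)) ≫ J.inv =
      e'.inv ×ₘ 𝟙 u := by
    ext <;> simp [J]
  have hQ : J.hom ≫ (((e Y).hom ×ₘ 𝟙 u) : ((S₁.base.obj (A Y), u) : D₁ × SingleObj ℕ+) ⟶ (Y, u)) ≫ (f ×ₘ n) =
      (((e'.hom ≫ f ≫ (e X).inv) ×ₘ 𝟙 u) : ((S₁.base.obj A', u) : D₁ × SingleObj ℕ+) ⟶ (S₁.base.obj (A X), u)) ≫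
        (𝟙 (S₁.base.obj (A X)) ×ₘ n) ≫ ((e X).hom ×ₘ 𝟙 u') := by
    ext <;> simp [J]
  rw [reassoc_of% eL, reassoc_of% h3, reassoc_of% h1, h2']
  simp only [Functor.mapIso_inv, Functor.mapIso_hom, Category.assoc, ← G.map_comp_assoc, ← G'.map_comp]
  rw [hP, hQ]

variable (S₁) in
/-- Rigidity of `T ⋙ (C₁ → D₁)` implies rigidity of `T ⋙ (C₁ → D₁ × N_{≥1})`: an automorphism of the
latter has invertible, hence trivial, `N_{≥1}`-components, and its `D₁`-components form an automorphism of
the former ("the rigidity assertion follows from Proposition 1.13, (i)", FrdI Cor. 4.12 p. 95).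
[cite: MochizukiFrdI2008, Cor. 4.12 p.95] -/
theorem isRigidFunctor_comp_toBaseDeg {P : Type u₃} [Category.{v₃} P] (T : P ⥤ C₁)
    (h : IsRigidFunctor (T ⋙ S₁.base)) : IsRigidFunctor (T ⋙ S₁.toBaseDeg) := by
  intro α
  -- the `D₁`-components
  let β : T ⋙ S₁.base ≅ T ⋙ S₁.base := NatIso.ofComponents
    (fun X => ⟨(α.hom.app X).1, (α.inv.app X).1, congrArg Prod.fst (α.hom_inv_id_app X),
      congrArg Prod.fst (α.inv_hom_id_app X)⟩)
    (fun {X Y} f => congrArg Prod.fst (α.hom.naturality f))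
  have hβ : ∀ X, (α.hom.app X).1 = 𝟙 _ := fun X => by
    have := congrArg (fun γ : T ⋙ S₁.base ≅ T ⋙ S₁.base => γ.hom.app X) (h β)
    exact this
  -- the `N_{≥1}`-components
  have h2 : ∀ X, (α.hom.app X).2 = 𝟙 _ := fun X => by
    obtain ⟨a, ha⟩ : ∃ a : ℕ+, a = (α.hom.app X).2 := ⟨_, rfl⟩
    obtain ⟨b, hb⟩ : ∃ b : ℕ+, b = (α.inv.app X).2 := ⟨_, rfl⟩
    have hinv : (α.hom.app X).2 ≫ (α.inv.app X).2 = 𝟙 _ := congrArg Prod.snd (α.hom_inv_id_app X)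
    rw [← ha, ← hb] at hinv
    -- in the one-object category of `N_{≥1}`: `a ≫ b = b * a` and `𝟙 = 1`
    have hmul : b * a = 1 := hinv
    have hnat : (b : ℕ) * (a : ℕ) = 1 := by exact_mod_cast congrArg PNat.val hmul
    have ha1 : a = 1 := PNat.coe_eq_one_iff.mp (Nat.eq_one_of_mul_eq_one_left hnat)
    rw [← ha, ha1]
    rfl
  ext X
  · exact hβ X
  · exact h2 X

end OneFrobenioid

section TwoFrobenioids

variable {C₁ : Type u₁} [Category.{v₁} C₁] {D₁ : Type u₁'} [Category.{v₁'} D₁]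
variable {C₂ : Type u₂} [Category.{v₂} C₂] {D₂ : Type u₂'} [Category.{v₂'} D₂]
variable (S₁ : PreFrobenioidData.{w₁} C₁ D₁) (S₂ : PreFrobenioidData.{w₂} C₂ D₂) (Ψ : C₁ ≌ C₂)

/-- Under Def. 1.3 (i)(a)(b)(c), (ii), (iv)(b) of `C₁ → D₁` (operations form), ANY equivalence
`Ψ⁰ : D₁ × N_{≥1} ⥤ D₂ × N_{≥1}` that `1`-commutes with `Ψ` over the projections `C_i → D_i × N_{≥1}` is
`1`-unique — the typed `OneUniqueSquare` of Cor. 4.12 (FrdI p. 95). [cite: MochizukiFrdI2008, Cor. 4.12 p.95] -/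
theorem oneUniqueSquare_toBaseDeg_of_oneCommutes
    (hbase : ∀ X : D₁, ∃ A : C₁, Nonempty (S₁.base.obj A ≅ X))
    (hconn : ∀ (A B : C₁) (g : S₁.base.obj A ≅ S₁.base.obj B), ∃ (X : C₁) (φ : X ⟶ A) (ψ : X ⟶ B),
      IsIso (S₁.base.map φ) ∧ S₁.degFr φ = 1 ∧ S₁.degFr ψ = 1 ∧ S₁.base.map φ ≫ g.hom = S₁.base.map ψ)
    (hpb : ∀ (A : C₁) {Y : D₁} (f : Y ⟶ S₁.base.obj A),
      ∃ (A' : C₁) (φ : A' ⟶ A) (e : S₁.base.obj A' ≅ Y), S₁.base.map φ = e.hom ≫ f ∧ S₁.degFr φ = 1)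
    (hfrob : ∀ (A : C₁) (n : ℕ+), ∃ (B : C₁) (γ : A ⟶ B), IsIso (S₁.base.map γ) ∧ S₁.degFr γ = n)
    (Ψ0 : D₁ × SingleObj ℕ+ ⥤ D₂ × SingleObj ℕ+) [Ψ0.IsEquivalence]
    (hsq : OneCommutes Ψ.functor S₂.toBaseDeg S₁.toBaseDeg Ψ0) :
    OneUniqueSquare Ψ.functor S₁.toBaseDeg S₂.toBaseDeg Ψ0 := by
  refine ⟨inferInstance, hsq, fun B' hB' => ?_⟩
  obtain ⟨η⟩ := hsq
  obtain ⟨η'⟩ := hB'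
  exact nonempty_iso_of_iso_whisker_toBaseDeg hbase hconn hpb hfrob (η'.symm ≪≫ η)

/-- A base square for `Ψ` with `Ψ^Base` an equivalence, together with "`Ψ` preserves Frobenius degrees"
(Thm. 3.4 (iii)/(iv)), yields the equivalence `Ψ⁰ := Ψ^Base × id : D₁ × N_{≥1} ⥲ D₂ × N_{≥1}` `1`-commuting
with `Ψ` over the projections `C_i → D_i × N_{≥1}` (the situation of Cor. 4.11 (ii), (iv); FrdI Cor. 4.12
p. 95). [cite: MochizukiFrdI2008, Cor. 4.12 p.95] -/
theorem exists_toBaseDeg_equivalence_of_base_square (ΨBase : D₁ ⥤ D₂) [ΨBase.IsEquivalence]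
    (η : Ψ.functor ⋙ S₂.base ≅ S₁.base ⋙ ΨBase) (hdeg : PreservesDegFr S₁ S₂ Ψ) :
    ∃ Ψ0 : D₁ × SingleObj ℕ+ ⥤ D₂ × SingleObj ℕ+,
      Ψ0.IsEquivalence ∧ OneCommutes Ψ.functor S₂.toBaseDeg S₁.toBaseDeg Ψ0 := by
  let θ : ∀ A : C₁, S₂.base.obj (Ψ.functor.obj A) ≅ ΨBase.obj (S₁.base.obj A) := fun A => η.app A
  have hθ : ∀ ⦃A B : C₁⦄ (φ : A ⟶ B),
      S₂.base.map (Ψ.functor.map φ) ≫ (θ B).hom = (θ A).hom ≫ ΨBase.map (S₁.base.map φ) :=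
    fun A B φ => η.hom.naturality φ
  refine ⟨ΨBase.prod (𝟭 (SingleObj ℕ+)),
    (ΨBase.asEquivalence.prod (CategoryTheory.Equivalence.refl (C := SingleObj ℕ+))).isEquivalence_functor,
    ⟨?_⟩⟩
  refine NatIso.ofComponents (fun A => Iso.prod (θ A) (Iso.refl (SingleObj.star ℕ+))) ?_
  intro A B φ
  ext
  · exact hθ φ
  · -- second components: `deg_Fr(Ψ φ) ≫ 𝟙 = 𝟙 ≫ deg_Fr(φ)` in the one-object category of `N_{≥1}`
    simp only [prod_comp_snd, Iso.prod_hom, Iso.refl_hom, Functor.comp_map, Functor.prod_map, Functor.id_map]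
    exact (Category.comp_id ((S₂.toBaseDeg.map (Ψ.functor.map φ)).2)).trans
      ((hdeg φ).trans (Category.id_comp ((S₁.toBaseDeg.map φ).2)).symm)

/-- **Corollary 4.12 REDUCED** (FrdI pp. 94–95): under Def. 1.3 (i)(a)(b)(c), (ii), (iv)(b) of
`C₁ → D₁` (operations form), the typed Cor. 4.12 follows from (E⁰) the EXISTENCE of an equivalence
`Ψ⁰ : D₁ × N_{≥1} ⥲ D₂ × N_{≥1}` `1`-commuting with `Ψ` over the projections — in print obtained "by
applying Corollary 4.10 … followed by Theorem 3.4, (iv)" via `C_i → C_i^birat → (C_i^birat)^un-tr` — and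
(R) the rigidity of `Base₂ ∘ Ψ` on slim bases ("the rigidity assertion follows from Proposition 1.13,
(i)"). [cite: MochizukiFrdI2008, Cor. 4.12 p.95] -/
theorem cor412_of_exists_toBaseDeg_equivalence (R₁ : S₁.RSParams) (R₂ : S₂.RSParams)
    (hbase : ∀ X : D₁, ∃ A : C₁, Nonempty (S₁.base.obj A ≅ X))
    (hconn : ∀ (A B : C₁) (g : S₁.base.obj A ≅ S₁.base.obj B), ∃ (X : C₁) (φ : X ⟶ A) (ψ : X ⟶ B),
      IsIso (S₁.base.map φ) ∧ S₁.degFr φ = 1 ∧ S₁.degFr ψ = 1 ∧ S₁.base.map φ ≫ g.hom = S₁.base.map ψ)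
    (hpb : ∀ (A : C₁) {Y : D₁} (f : Y ⟶ S₁.base.obj A),
      ∃ (A' : C₁) (φ : A' ⟶ A) (e : S₁.base.obj A' ≅ Y), S₁.base.map φ = e.hom ≫ f ∧ S₁.degFr φ = 1)
    (hfrob : ∀ (A : C₁) (n : ℕ+), ∃ (B : C₁) (γ : A ⟶ B), IsIso (S₁.base.map γ) ∧ S₁.degFr γ = n)
    (hex : ∃ Ψ0 : D₁ × SingleObj ℕ+ ⥤ D₂ × SingleObj ℕ+,
      Ψ0.IsEquivalence ∧ OneCommutes Ψ.functor S₂.toBaseDeg S₁.toBaseDeg Ψ0)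
    (hrig : IsSlim D₁ → IsSlim D₂ → IsRigidFunctor (Ψ.functor ⋙ S₂.base)) : Cor412 S₁ S₂ Ψ R₁ R₂ := by
  intro _ _ _ _ _
  obtain ⟨Ψ0, hEq, hsq⟩ := hex
  haveI := hEq
  refine ⟨Ψ0, oneUniqueSquare_toBaseDeg_of_oneCommutes S₁ S₂ Ψ hbase hconn hpb hfrob Ψ0 hsq, fun h₁ h₂ => ?_⟩
  obtain ⟨ι⟩ := hsq
  have hr : IsRigidFunctor (Ψ.functor ⋙ S₂.toBaseDeg) := S₂.isRigidFunctor_comp_toBaseDeg Ψ.functor (hrig h₁ h₂)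
  exact ⟨hr, isRigidFunctor_congr ι hr⟩

/-- **Corollary 4.12 from a base square** (FrdI pp. 94–95; the Div-slim situation of Cor. 4.11 (ii),
(iv)): under Def. 1.3 (i)(a)(b)(c), (ii), (iv)(b) of `C₁ → D₁` (operations form), a base square
`Base₂ ∘ Ψ ≅ Ψ^Base ∘ Base₁` with `Ψ^Base` an equivalence, the preservation of Frobenius degrees by `Ψ`, and
the rigidity of `Base₂ ∘ Ψ` on slim bases give the typed Cor. 4.12. [cite: MochizukiFrdI2008, Cor. 4.12 p.95] -/
theorem cor412_of_base_square (R₁ : S₁.RSParams) (R₂ : S₂.RSParams)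
    (hbase : ∀ X : D₁, ∃ A : C₁, Nonempty (S₁.base.obj A ≅ X))
    (hconn : ∀ (A B : C₁) (g : S₁.base.obj A ≅ S₁.base.obj B), ∃ (X : C₁) (φ : X ⟶ A) (ψ : X ⟶ B),
      IsIso (S₁.base.map φ) ∧ S₁.degFr φ = 1 ∧ S₁.degFr ψ = 1 ∧ S₁.base.map φ ≫ g.hom = S₁.base.map ψ)
    (hpb : ∀ (A : C₁) {Y : D₁} (f : Y ⟶ S₁.base.obj A),
      ∃ (A' : C₁) (φ : A' ⟶ A) (e : S₁.base.obj A' ≅ Y), S₁.base.map φ = e.hom ≫ f ∧ S₁.degFr φ = 1)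
    (hfrob : ∀ (A : C₁) (n : ℕ+), ∃ (B : C₁) (γ : A ⟶ B), IsIso (S₁.base.map γ) ∧ S₁.degFr γ = n)
    (ΨBase : D₁ ⥤ D₂) [ΨBase.IsEquivalence] (η : Ψ.functor ⋙ S₂.base ≅ S₁.base ⋙ ΨBase)
    (hdeg : PreservesDegFr S₁ S₂ Ψ) (hrig : IsSlim D₁ → IsSlim D₂ → IsRigidFunctor (Ψ.functor ⋙ S₂.base)) :
    Cor412 S₁ S₂ Ψ R₁ R₂ :=
  cor412_of_exists_toBaseDeg_equivalence S₁ S₂ Ψ R₁ R₂ hbase hconn hpb hfrob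
    (exists_toBaseDeg_equivalence_of_base_square S₁ S₂ Ψ ΨBase η hdeg) hrig

end TwoFrobenioids

end PreFrobenioidData

end Literature.AlgebraicGeometry.Frobenioids
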